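/-
Copyright: pub-rosobs cell (Resolution Observatory), carver gen 42.  Companion file; statements OURS, in
the cell's polynomial weighted-centre model `W(f)`.  Instrument — NOT a resolution theorem.
-/
import Literature.AlgebraicGeometry.Resolution.WeightedCentreHandlePowMax
import HarnessLib

/-!
# `q`-residual invariants: `W(X_a^q + h) ∋ sort (q, b)` for every residual invariant `b` of `h` (`q = p^n`)

[cite: AbramovichTemkinWlodarczyk2024, Thm. 5.3.1 (2)–(3) (p. 1578) (`inv = max (b₁,…,b_k)` over admissible
centres; independence of coordinates), Lemma 5.2.6 (p. 1576) (sums), Lemma 5.2.10 (p. 1577), §5.1 (p. 1575)]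
[cite: CossartJannsenSaito2020, Def. 8.2 (p. 118) / Thm. 8.16 (p. 121) (coordinate changes `y ↦ y + q(u)`)].

In characteristic `p`, next to a pure power `X_a^q`, `q = p^n`, the rest `h(y)` of `f = X_a^q + h` is only
determined up to `q`-th powers: the coordinate change `X_a ↦ X_a + γ(y)` replaces `h` by `h + γ^q`
(`(X_a + γ)^q = X_a^q + γ^q`).  Hence (`admissibleInvariants_X_pow_add_sub_pow`)

  `W(X_a^q + h) = W(X_a^q + (h − γ^q))`   for every polynomial `γ` free of `X_a` with `γ(0) = 0`,

generalising the absorption identity of `WeightedCentrePureHandleFamily` (`γ = Σ X_d^{t_d}` deletes the pure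
powers `X_d^{q t_d}`).  The census's `q`-RESIDUAL INVARIANTS of `h` (engine 1, FE35: `C_q(h)` = the maximum
of the invariants of centres `(z; w)` with `h ∈ I_w(z) + (q-th powers)`) are modelled by
`residualInvariants q a h` = the invariants `exps w` of centres `(Ψ, w)` living off `X_a` (`Ψ⁻¹ X_a = X_a`,
`w_a = 0`) admissible for `h − γ^q` for some such `γ`; and LEMMA L of FE35 (the additive lower bound) becomes
the theorem `insertionSort_cons_mem_admissibleInvariants_X_pow_add`:

  `sort (q, b) ∈ W(X_a^q + h)`   for every `b ∈ residualInvariants q a h` (`q = p^n`, `a ∉ vars h`),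

by the identity above and the block concatenation of `WeightedCentreBlockMerge`.  Consequently
`max W(X_a^q + h)`, when it exists, is not below `sort (q, b)` for any residual invariant `b`
(`not_lt_of_isMaxInv_X_pow_add`).  Worked instance of a genuine residual gain (characteristic 2):
`x² + (y² + y³z)`: the merge of `(2)` with `W(y² + y³z)` is poor, but `γ = y` leaves `y³z` with invariant
`(4, 4)`, and indeed `max W(x² + y² + y³z) = (2, 4, 4)` (`= W(x² + y³z)`, the umbrella law).
The reverse inequality (`max W(X_a^q + h) ≤ sort (q, C_q(h))`, FE35 Lemma R/S) needs a restriction step and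
is NOT claimed.
-/

noncomputable section

open MvPolynomial

namespace Literature.AlgebraicGeometry.Resolution.WeightedBlowup

variable {k : Type*} [Field k] {N : ℕ}

/-! ## §1 `W(X_a^q + h)` only sees `h` modulo `q`-th powers -/

/-- An algebra endomorphism fixing every variable of `P` fixes `P` (plumbing). [folklore] -/
private theorem algHom_eq_self_of_forall_vars₁₃ {σ K : Type*} [CommSemiring K]
    (Φ : MvPolynomial σ K →ₐ[K] MvPolynomial σ K) {P : MvPolynomial σ K}
    (h : ∀ x ∈ P.vars, Φ (X x) = X x) : Φ P = P := by
  change Φ.toRingHom P = RingHom.id _ P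
  refine hom_congr_vars ?_ (fun x hx _ => ?_) rfl
  · ext c
    simp
  · simpa using h x hx

/-- The shear `X_a ↦ X_a + γ` fixes every polynomial free of `X_a` (plumbing). [folklore] -/
private theorem addPolyShear_eq_self_of_notMem₁₃ (a : Fin N) (γ : MvPolynomial (Fin N) k)
    {P : MvPolynomial (Fin N) k} (hP : a ∉ P.vars) : addPolyShear a γ P = P :=
  algHom_eq_self_of_forall_vars₁₃ (addPolyShear a γ : MvPolynomial (Fin N) k →ₐ[k] MvPolynomial (Fin N) k)
    fun x hx => by
      have hxa : x ≠ a := fun h => hP (h ▸ hx)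
      simpa using addPolyShear_X_of_ne a γ hxa

section CharP

variable (p n : ℕ) [hp : Fact p.Prime] [CharP k p]

/-- **`W(X_a^q + h)` depends on `h` only modulo `q`-th powers** (`q = p^n` in characteristic `p`): for every
polynomial `γ` free of `X_a` with `γ(0) = 0` and every `h` free of `X_a`,
`W(X_a^q + (h − γ^q)) = W(X_a^q + h)` — the coordinate change `X_a ↦ X_a + γ` and `(X_a + γ)^q = X_a^q + γ^q`.
(derived here) [cite: AbramovichTemkinWlodarczyk2024, Thm. 5.3.1 (2)–(3) (p. 1578) (independence of coordinates)]
[cite: CossartJannsenSaito2020, Def. 8.2 (p. 118) (changes `y ↦ y + q(u)`)] -/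
theorem admissibleInvariants_X_pow_add_sub_pow (a : Fin N) {h γ : MvPolynomial (Fin N) k} (hh : a ∉ h.vars)
    (hγ : a ∉ γ.vars) (hγ0 : constantCoeff γ = 0) :
    admissibleInvariants (X a ^ p ^ n + (h - γ ^ p ^ n)) = admissibleInvariants (X a ^ p ^ n + h) := by
  classical
  haveI : ExpChar (MvPolynomial (Fin N) k) p := ExpChar.prime hp.out
  have h0 : ∀ x, constantCoeff (addPolyShear a γ (X x : MvPolynomial (Fin N) k)) = 0 :=
    constantCoeff_addPolyShear_X a hγ0
  have himage : addPolyShear a γ (X a ^ p ^ n + (h - γ ^ p ^ n)) = X a ^ p ^ n + h := by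
    rw [map_add, map_sub, map_pow, map_pow, addPolyShear_X_self_of_notMem a hγ,
      addPolyShear_eq_self_of_notMem₁₃ a γ hh, addPolyShear_eq_self_of_notMem₁₃ a γ hγ, add_pow_expChar_pow]
    ring
  rw [← himage, admissibleInvariants_map_eq _ h0]

/-- The same identity, additive form: `W(X_a^q + (h + γ^q)) = W(X_a^q + h)`. (derived here)
[cite: AbramovichTemkinWlodarczyk2024, Thm. 5.3.1 (2)–(3) (p. 1578)] -/
theorem admissibleInvariants_X_pow_add_add_pow (a : Fin N) {h γ : MvPolynomial (Fin N) k} (hh : a ∉ h.vars)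
    (hγ : a ∉ γ.vars) (hγ0 : constantCoeff γ = 0) :
    admissibleInvariants (X a ^ p ^ n + (h + γ ^ p ^ n)) = admissibleInvariants (X a ^ p ^ n + h) := by
  classical
  have hγ' : a ∉ (-γ).vars := by rwa [vars_neg]
  have hγ0' : constantCoeff (-γ) = 0 := by rw [map_neg, hγ0, neg_zero]
  have h := admissibleInvariants_X_pow_add_sub_pow p n a hh hγ' hγ0'
  haveI : ExpChar (MvPolynomial (Fin N) k) p := ExpChar.prime hp.out
  rwa [neg_pow, neg_one_pow_expChar_pow _ p n, neg_one_mul, sub_neg_eq_add] at h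

end CharP

/-! ## §2 Residual invariants and Lemma L -/

/-- **`q`-residual admissible invariants of `h` relative to the variable `X_a`** (the census's `C_q`-data,
engine 1 FE35, in the polynomial model): the invariants `exps w` of centres `(Ψ, w)` living off `X_a`
(`Ψ⁻¹ X_a = X_a`, `w_a = 0`) that are admissible for `h − γ^q` for some polynomial `γ` free of `X_a` with
`γ(0) = 0`. OURS (derived here; models `{inv(z; w) : h ∈ I_w(z) + (q-th powers)}`).
[cite: AbramovichTemkinWlodarczyk2024, §5.1 (p. 1575), Thm. 5.3.1 (2) (p. 1578)] -/
def residualInvariants (q : ℕ) (a : Fin N) (h : MvPolynomial (Fin N) k) : Set (List ℚ) :=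
  {b | ∃ (γ : MvPolynomial (Fin N) k) (Ψ : MvPolynomial (Fin N) k ≃ₐ[k] MvPolynomial (Fin N) k)
      (w : Fin N → ℚ), a ∉ γ.vars ∧ constantCoeff γ = 0 ∧ Ψ.symm (X a) = X a ∧ w a = 0 ∧
        IsCentreFor (h - γ ^ q) Ψ w ∧ exps w = b}

/-- Unfolding (plumbing). [cite: AbramovichTemkinWlodarczyk2024, §5.1 (p. 1575)] -/
theorem mem_residualInvariants_iff {q : ℕ} {a : Fin N} {h : MvPolynomial (Fin N) k} {b : List ℚ} :
    b ∈ residualInvariants q a h ↔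
      ∃ (γ : MvPolynomial (Fin N) k) (Ψ : MvPolynomial (Fin N) k ≃ₐ[k] MvPolynomial (Fin N) k)
        (w : Fin N → ℚ), a ∉ γ.vars ∧ constantCoeff γ = 0 ∧ Ψ.symm (X a) = X a ∧ w a = 0 ∧
          IsCentreFor (h - γ ^ q) Ψ w ∧ exps w = b :=
  Iff.rfl

/-- Every invariant of a centre for `h` itself living off `X_a` is a residual invariant (`γ = 0`, `q ≥ 1`):
`W_{off a}(h) ⊆ residualInvariants q a h`. (derived here) [cite: AbramovichTemkinWlodarczyk2024, §5.1 (p. 1575)] -/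
theorem exps_mem_residualInvariants {q : ℕ} (hq : q ≠ 0) {a : Fin N} {h : MvPolynomial (Fin N) k}
    {Ψ : MvPolynomial (Fin N) k ≃ₐ[k] MvPolynomial (Fin N) k} {w : Fin N → ℚ} (hΨa : Ψ.symm (X a) = X a)
    (hwa : w a = 0) (hc : IsCentreFor h Ψ w) : exps w ∈ residualInvariants q a h :=
  ⟨0, Ψ, w, by simp, map_zero _, hΨa, hwa, by rwa [zero_pow hq, sub_zero], rfl⟩

/-- A residual invariant presented by an explicit `γ` and a COORDINATE centre `w` off `X_a` (plumbing for
instances). (derived here) [cite: AbramovichTemkinWlodarczyk2024, §5.1 (p. 1575)] -/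
theorem exps_mem_residualInvariants_of_isAdmissibleFor {q : ℕ} {a : Fin N} {h γ : MvPolynomial (Fin N) k}
    (hγ : a ∉ γ.vars) (hγ0 : constantCoeff γ = 0) {w : Fin N → ℚ} (hw : ∀ x, 0 ≤ w x) (hwa : w a = 0)
    (hadm : IsAdmissibleFor w (h - γ ^ q)) : exps w ∈ residualInvariants q a h :=
  ⟨γ, AlgEquiv.refl, w, hγ, hγ0, rfl, hwa, ⟨fun x => constantCoeff_X k x, hw, hadm⟩, rfl⟩

section CharP

variable (p n : ℕ) [hp : Fact p.Prime] [CharP k p]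

/-- **Lemma L (the additive lower bound of the census's `q`-residual predictor, engine 1 FE35), typed:**
in characteristic `p`, `q = p^n`, `h` free of `X_a`: for every residual invariant `b ∈ residualInvariants q a h`,
`sort (q, b) ∈ W(X_a^q + h)` — realised by the concatenation of the block centre `(X_a; 1/q)` with the residual
centre, in the coordinates `X_a ↦ X_a + γ`. (derived here)
[cite: AbramovichTemkinWlodarczyk2024, Lemma 5.2.6 (p. 1576), Lemma 5.2.10 (p. 1577), Thm. 5.3.1 (2)–(3) (p. 1578)] -/
theorem insertionSort_cons_mem_admissibleInvariants_X_pow_add (a : Fin N) {h : MvPolynomial (Fin N) k}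
    (hh : a ∉ h.vars) {b : List ℚ} (hb : b ∈ residualInvariants (p ^ n) a h) :
    (((p ^ n : ℕ) : ℚ) :: b).insertionSort (· ≤ ·) ∈ admissibleInvariants (X a ^ p ^ n + h) := by
  classical
  obtain ⟨γ, Ψ, w, hγ, hγ0, hΨa, hwa, hc, rfl⟩ := hb
  have hq : 0 < p ^ n := pow_pos hp.out.pos n
  rw [← admissibleInvariants_X_pow_add_sub_pow p n a hh hγ hγ0]
  have hdisj : ∀ x, singleWeights a (p ^ n) x = 0 ∨ w x = 0 := by
    intro x
    by_cases hx : x = a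
    · rw [hx]; exact Or.inr hwa
    · left; rw [singleWeights, if_neg hx]
  have hmem := merge_mem_admissibleInvariants_add (isCentreFor_X_pow (k := k) a hq) hc
    (by rw [map_pow, hΨa]) (by simp) hdisj
  rw [exps_singleWeights a hq, List.singleton_append] at hmem
  exact hmem

/-- **Residual invariants see `h` only modulo `q`-th powers** (`q = p^n`): adding `γ₀^q`, `γ₀` free of `X_a`
with `γ₀(0) = 0`, does not lose residual invariants (witness `γ ↦ γ + γ₀`). (derived here)
[cite: AbramovichTemkinWlodarczyk2024, §5.1 (p. 1575)] -/
theorem residualInvariants_subset_add_pow (a : Fin N) {h γ₀ : MvPolynomial (Fin N) k} (hγ₀ : a ∉ γ₀.vars)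
    (hγ₀0 : constantCoeff γ₀ = 0) :
    residualInvariants (p ^ n) a h ⊆ residualInvariants (p ^ n) a (h + γ₀ ^ p ^ n) := by
  classical
  haveI : ExpChar (MvPolynomial (Fin N) k) p := ExpChar.prime hp.out
  rintro b ⟨γ, Ψ, w, hγ, hγ0, hΨa, hwa, hc, rfl⟩
  refine ⟨γ + γ₀, Ψ, w, fun hmem => ?_, by rw [map_add, hγ0, hγ₀0, add_zero], hΨa, hwa, ?_, rfl⟩
  · rcases Finset.mem_union.mp (vars_add_subset _ _ hmem) with h1 | h2
    · exact hγ h1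
    · exact hγ₀ h2
  · have hrw : h + γ₀ ^ p ^ n - (γ + γ₀) ^ p ^ n = h - γ ^ p ^ n := by
      rw [add_pow_expChar_pow]
      ring
    rw [hrw]
    exact hc

/-- … and conversely: **`residualInvariants q a (h + γ₀^q) = residualInvariants q a h`** (`q = p^n`; the
census's `C_q(h)` is well defined on `h` modulo `q`-th powers). (derived here)
[cite: AbramovichTemkinWlodarczyk2024, §5.1 (p. 1575), Thm. 5.3.1 (3) (p. 1578)] -/
theorem residualInvariants_add_pow (a : Fin N) {h γ₀ : MvPolynomial (Fin N) k} (hγ₀ : a ∉ γ₀.vars)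
    (hγ₀0 : constantCoeff γ₀ = 0) :
    residualInvariants (p ^ n) a (h + γ₀ ^ p ^ n) = residualInvariants (p ^ n) a h := by
  classical
  haveI : ExpChar (MvPolynomial (Fin N) k) p := ExpChar.prime hp.out
  refine Set.Subset.antisymm ?_ (residualInvariants_subset_add_pow p n a hγ₀ hγ₀0)
  have hγ' : a ∉ (-γ₀).vars := by rwa [vars_neg]
  have hγ0' : constantCoeff (-γ₀) = 0 := by rw [map_neg, hγ₀0, neg_zero]
  have h2 := residualInvariants_subset_add_pow p n a (h := h + γ₀ ^ p ^ n) hγ' hγ0'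
  rwa [neg_pow, neg_one_pow_expChar_pow _ p n, neg_one_mul, add_neg_cancel_right] at h2

/-- **`max W(X_a^q + h)` is not below `sort (q, b)`** for any residual invariant `b` of `h` (`q = p^n`,
`h` free of `X_a`). (derived here) [cite: AbramovichTemkinWlodarczyk2024, Thm. 5.3.1 (2) (p. 1578)] -/
theorem not_lt_of_isMaxInv_X_pow_add (a : Fin N) {h : MvPolynomial (Fin N) k} (hh : a ∉ h.vars)
    {v : List ℚ} (hv : IsMaxInv (admissibleInvariants (X a ^ p ^ n + h)) v) {b : List ℚ}
    (hb : b ∈ residualInvariants (p ^ n) a h) :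
    ¬ ATW.TruncLex.lt v ((((p ^ n : ℕ) : ℚ) :: b).insertionSort (· ≤ ·)) :=
  hv.2 _ (insertionSort_cons_mem_admissibleInvariants_X_pow_add p n a hh hb)

/-- **Transport of a maximum through a residual correction**: if `max W(X_a^q + (h − γ^q)) = v` then
`max W(X_a^q + h) = v` (`q = p^n`; `γ`, `h` free of `X_a`, `γ(0) = 0`). (derived here)
[cite: AbramovichTemkinWlodarczyk2024, Thm. 5.3.1 (2)–(3) (p. 1578)] -/
theorem isMaxInv_X_pow_add_of_sub_pow (a : Fin N) {h γ : MvPolynomial (Fin N) k} (hh : a ∉ h.vars)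
    (hγ : a ∉ γ.vars) (hγ0 : constantCoeff γ = 0) {v : List ℚ}
    (hv : IsMaxInv (admissibleInvariants (X a ^ p ^ n + (h - γ ^ p ^ n))) v) :
    IsMaxInv (admissibleInvariants (X a ^ p ^ n + h)) v := by
  rw [← admissibleInvariants_X_pow_add_sub_pow p n a hh hγ hγ0]
  exact hv

end CharP

/-! ## §3 Worked instances (characteristic 2) -/

/-- `x` does not occur in `y² + y³z` (plumbing). [folklore] -/
private theorem zero_notMem_vars_y2_y3z :
    (0 : Fin 3) ∉ (X 1 ^ 2 + X 1 ^ 3 * X 2 : MvPolynomial (Fin 3) k).vars := by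
  classical
  intro hmem
  rcases Finset.mem_union.mp (vars_add_subset _ _ hmem) with h1 | h2
  · have h1' := vars_pow _ _ h1
    simp [vars_X] at h1'
  · rcases Finset.mem_union.mp (vars_mul _ _ h2) with h3 | h4
    · have h3' := vars_pow _ _ h3
      simp [vars_X] at h3'
    · simp [vars_X] at h4

/-- A genuine residual gain: in characteristic `2`, `(4, 4)` is a `2`-residual invariant of `h = y² + y³z`
relative to `x` (`γ = y` leaves `y³z`, centre `(y, z)` with weights `(1/4, 1/4)`), although `ord h = 2`.
(derived here) [cite: AbramovichTemkinWlodarczyk2024, §5.1 (p. 1575)] -/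
theorem residualInvariants_instance_y2_y3z :
    ([4, 4] : List ℚ) ∈ residualInvariants 2 (0 : Fin 3) (X 1 ^ 2 + X 1 ^ 3 * X 2 : MvPolynomial (Fin 3) k) := by
  classical
  have he : exps (singleWeights (1 : Fin 3) (3 + 1) + singleWeights 2 (3 + 1)) = [4, 4] := by
    rw [exps_handleWeights (by decide)]
    norm_num
  rw [← he]
  refine exps_mem_residualInvariants_of_isAdmissibleFor (γ := X 1) (by simp [vars_X])
    (constantCoeff_X k 1) (fun x => ?_) (by simp [singleWeights]) ?_
  · simp only [Pi.add_apply, singleWeights]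
    split_ifs <;> norm_num
  · have hsub : (X 1 ^ 2 + X 1 ^ 3 * X 2 : MvPolynomial (Fin 3) k) - X 1 ^ 2 = X 1 ^ 3 * X 2 := by ring
    rw [hsub]
    exact isAdmissibleFor_handle (by decide) 3

/-- Hence `sort (2, 4, 4) = (2, 4, 4) ∈ W(x² + (y² + y³z))` in characteristic `2` by Lemma L — although
`y² + y³z = y²(1 + yz)` itself admits nothing beyond `(2)`-type centres. (derived here)
[cite: AbramovichTemkinWlodarczyk2024, Lemma 5.2.6 (p. 1576), Thm. 5.3.1 (2) (p. 1578)] -/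
example [CharP k 2] :
    ([2, 4, 4] : List ℚ) ∈
      admissibleInvariants (X 0 ^ 2 ^ 1 + (X 1 ^ 2 + X 1 ^ 3 * X 2) : MvPolynomial (Fin 3) k) := by
  classical
  have hb : ([4, 4] : List ℚ) ∈ residualInvariants (2 ^ 1) (0 : Fin 3)
      (X 1 ^ 2 + X 1 ^ 3 * X 2 : MvPolynomial (Fin 3) k) := by
    rw [pow_one]
    exact residualInvariants_instance_y2_y3z
  have h := insertionSort_cons_mem_admissibleInvariants_X_pow_add (k := k) 2 1 (0 : Fin 3)
    (h := X 1 ^ 2 + X 1 ^ 3 * X 2) zero_notMem_vars_y2_y3z hb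
  norm_num [List.insertionSort] at h
  exact h

/-- And the maximum itself: `max W(x² + (y² + y³z)) = (2, 4, 4)` in characteristic `2` — transport through the
residual correction `γ = y` to the umbrella `x² + y³z` (`isMaxInv_X_pow_add_X_pow_mul_X`). (derived here)
[cite: AbramovichTemkinWlodarczyk2024, Thm. 5.3.1 (2)–(3) (p. 1578)] -/
example [CharP k 2] :
    IsMaxInv (admissibleInvariants (X 0 ^ 2 ^ 1 + (X 1 ^ 2 + X 1 ^ 3 * X 2) : MvPolynomial (Fin 3) k))
      [2, 4, 4] := by
  classical
  have hu := isMaxInv_X_pow_add_X_pow_mul_X (k := k) (N := 3) (i := 0) (j := 1) (l := 2) (p := 2) (m := 3)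
    (by decide) (by decide) (by decide) le_rfl (by norm_num)
  norm_num at hu
  refine isMaxInv_X_pow_add_of_sub_pow (k := k) 2 1 (0 : Fin 3) (h := X 1 ^ 2 + X 1 ^ 3 * X 2) (γ := X 1)
    zero_notMem_vars_y2_y3z (by simp [vars_X]) (constantCoeff_X k 1) ?_
  have hsub : (X 1 ^ 2 + X 1 ^ 3 * X 2 : MvPolynomial (Fin 3) k) - X 1 ^ 2 ^ 1 = X 1 ^ 3 * X 2 := by ring
  rw [hsub, pow_one]
  exact hu

end Literature.AlgebraicGeometry.Resolution.WeightedBlowup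

end
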